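import Mathlib
import Summits.PneNP.PneNP.Theses.OverlapGapAlgebra

/-!
# Sketch — crux-ideate `stmt-PneNP-2462` (`NoStableSection`), ideator 2, round 1

First-lemma signatures for the two idea cards

* card A `bh-entropy-ladder`   : `condEnt_lipschitz` (BH Lemma 4.8) and the abstract
  deterministic `extraction` skeleton (BH Prop. 4.6 with the map `g` eliminated);
* card B `sharp-dart-small-ball` (working name `cellwise-cover-energy`): `energySum_telescope`
  (exact first-occurrence telescoping of the energy functional of BH Lemma 5.1),
  `new_of_conflict` (cell-wise constancy of earlier rungs, PROVED) and the conjectured inequality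
  `CoverEnergyConjecture`;
* card C `timeout-rung-gfree-ladder`: `extraction_total` (BH Prop 4.6 with the hole folded into
  the ladder as "timeout" rungs — no probabilistic hypothesis left) and the transfer target
  `TrajectoryForm` with `trajectoryForm_imp : TrajectoryForm → NoStableSection` (PROVED).

Nothing below is used by the route file; statements only (proof obligations `sorry`).
-/

set_option linter.dupNamespace false

namespace Summit.PneNP.PneNP.Cruxes.NoStableSection.SketchIdeator2

open Finset Classical

noncomputable section

/-- binary entropy in nats, `H(p) = -p log p - (1-p) log (1-p)` (Mathlib's `Real.negMulLog`). -/
def binEnt (p : ℝ) : ℝ := Real.negMulLog p + Real.negMulLog (1 - p)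

variable {n : ℕ}

/-- ORDERED history of coordinate `i` under the earlier rungs `ys` (BH use the gauge-quotient by a
global flip; the ordered variant has the same chain rule, counting bound and dart game). -/
def hist (ys : List (Fin n → Bool)) (i : Fin n) : List Bool := ys.map (fun y => y i)

/-- the cell of coordinates whose history is `h` -/
def cell (ys : List (Fin n → Bool)) (h : List Bool) : Finset (Fin n) :=
  univ.filter fun i => hist ys i = h

/-- BH conditional overlap entropy `H(π(x | ys))` (nats per coordinate, ordered variant):
`Σ_cells (|cell|/n) · H(fraction of the cell on which x = true)`. -/
def condEnt (ys : List (Fin n → Bool)) (x : Fin n → Bool) : ℝ :=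
  ∑ h ∈ univ.image (hist ys),
    (((cell ys h).card : ℝ) / n) *
      binEnt ((((cell ys h).filter fun i => x i = true).card : ℝ) / (cell ys h).card)

/-- **Card A, first lemma** (BH Lemma 4.8): an `ηn`-move of `x` moves `H(π(x | ys))` by at most
`H(η)` — the only place the stability hypothesis `S_consec` of `NoStableSection` is consumed. -/
theorem condEnt_lipschitz (ys : List (Fin n → Bool)) (x x' : Fin n → Bool) (hn : 0 < n)
    (hd : (hammingDist x x' : ℝ) ≤ n / 2) :
    |condEnt ys x - condEnt ys x'| ≤ binEnt ((hammingDist x x' : ℝ) / n) := by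
  sorry

/-- **Card A, deterministic skeleton** (BH Prop. 4.6 with the map eliminated): a novelty
functional `Hn` that vanishes on repeats, moves by `≤ δ` per step, and is forced above `hi` one
window `W` after every earlier rung (= the event `S_indep` read on this path), yields `L` in-band
rungs, consecutive ones at most `W` apart (so all inside `L * W ≤ T`).  Instantiation:
`V = Fin n → Bool`, `Hn = condEnt`, `x t = g (Φᵗ)`, `W = k*m` (one sweep), `L = k`, `T = k^2 m`,
`δ = H(η)`, `[lo, hi] = [β⁻, β⁺]·log k / k`; the conclusion is the structure forbidden by `S_ogp`. -/
theorem extraction {V : Type*} (Hn : List V → V → ℝ) (x : ℕ → V) (T W L : ℕ)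
    (lo hi δ : ℝ) (hLW : L * W ≤ T) (hδ : 0 ≤ δ) (hlo : 0 < lo) (hband : lo + δ ≤ hi)
    (h_rep : ∀ (ts : List ℕ) (t : ℕ), t ∈ ts → Hn (ts.map x) (x t) = 0)
    (h_step : ∀ (ts : List ℕ) (t : ℕ), t < T →
      |Hn (ts.map x) (x (t + 1)) - Hn (ts.map x) (x t)| ≤ δ)
    (h_far : ∀ (ts : List ℕ) (t' : ℕ), ts ≠ [] → t' ≤ T → (∀ t ∈ ts, t + W ≤ t') →
      hi < Hn (ts.map x) (x t')) :
    ∃ ts : ℕ → ℕ, ts 0 = 0 ∧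
      (∀ l, l < L → ts l < ts (l + 1) ∧ ts (l + 1) ≤ ts l + W) ∧
      (∀ l, l < L →
        lo ≤ Hn (((List.range (l + 1)).map ts).map x) (x (ts (l + 1))) ∧
        Hn (((List.range (l + 1)).map ts).map x) (x (ts (l + 1))) ≤ hi) := by
  sorry

/-! ### Card B — exact telescoping of the energy and the cell-wise cover game -/

/-- restriction of an assignment to a `k`-sample of coordinates (BH's `y[I]`) -/
def restr {k : ℕ} (I : Fin k → Fin n) (y : Fin n → Bool) : Fin k → Bool := fun r => y (I r)

/-- the energy functional of BH Lemma 5.1, `E_I |{y^ℓ[I] : ℓ}|`, as a sum over all samples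
`I : Fin k → Fin n` (divide by `n^k`). -/
def energySum (k : ℕ) {L : ℕ} (y : Fin (L + 1) → Fin n → Bool) : ℕ :=
  ∑ I : Fin k → Fin n, (univ.image fun l : Fin (L + 1) => restr I (y l)).card

/-- rung `l` is NEW on the sample `I`: its restriction differs from every earlier rung's. -/
def IsNew {k L : ℕ} (y : Fin (L + 1) → Fin n → Bool) (I : Fin k → Fin n) (l : Fin (L + 1)) : Prop :=
  ∀ j : Fin (L + 1), j < l → restr I (y j) ≠ restr I (y l)

/-- **Card B, first lemma** (exact first-occurrence telescoping; no truncation, no `1 - 1/log k`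
loss): energy = number of (sample, rung) pairs at which the rung is new (rung `0` is always new). -/
theorem energySum_telescope (k : ℕ) {L : ℕ} (y : Fin (L + 1) → Fin n → Bool) :
    energySum k y = ∑ I : Fin k → Fin n, (univ.filter fun l : Fin (L + 1) => IsNew y I l).card := by
  sorry

/-- **Card B, conflict lemma**: earlier rungs are constant on the cells of their own history
partition, so two sampled coordinates of ONE cell carrying DIFFERENT bits of rung `l` certify that
rung `l` is new on that sample (kills the `log₂ k` fair-coin adversary of the abstract dart game). -/
theorem new_of_conflict {k L : ℕ} (y : Fin (L + 1) → Fin n → Bool) (l : Fin (L + 1))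
    (I : Fin k → Fin n) (r r' : Fin k)
    (hcell : hist ((List.ofFn y).take l.val) (I r) = hist ((List.ofFn y).take l.val) (I r'))
    (hbits : y l (I r) ≠ y l (I r')) :
    IsNew y I l := by
  intro j hj heq
  have hjl : j.val < l.val := hj
  have hmem : y j ∈ (List.ofFn y).take l.val := by
    rw [List.mem_take_iff_getElem]
    refine ⟨j.val, ?_, ?_⟩
    · simp only [List.length_ofFn, lt_min_iff]
      exact ⟨hjl, j.isLt⟩
    · simp only [List.getElem_ofFn, Fin.eta]
  have hconst : y j (I r) = y j (I r') := List.map_inj_left.1 hcell (y j) hmem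
  have h1 : y j (I r) = y l (I r) := congrFun heq r
  have h2 : y j (I r') = y l (I r') := congrFun heq r'
  exact hbits (h1 ▸ h2 ▸ hconst)

/-- **Card B, top-atom lemma** (row-structure-free part): on the samples `I` with no intra-cell
conflict, the failure event `¬ IsNew` has, cell-histories being fixed, probability at most the mass
of the `l` heaviest atoms of the product measure `⊗_r Bern(ρ(I r))`; stated here in its simplest
consequence, the union-free single-atom bound: if every earlier rung is at Hamming distance `≥ d`
from rung `l` then at most `l · (n - d)^k` samples fail.  (The card's conjecture sharpens the union
`l ·` to `1 + β + o(1)` using `new_of_conflict`.) -/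
theorem notNew_card_le {k L : ℕ} (y : Fin (L + 1) → Fin n → Bool) (l : Fin (L + 1)) (d : ℕ)
    (hd : ∀ j : Fin (L + 1), j < l → d ≤ hammingDist (y j) (y l)) :
    ((univ : Finset (Fin k → Fin n)).filter fun I => ¬ IsNew y I l).card ≤ l.val * (n - d) ^ k := by
  sorry

/-- **Card B, the conjectured cell-wise cover inequality** (replacing BH Prop. 5.2's per-rung
energy `1 - β e^{1-β}` by `1 - (1 + β) e^{-β}` up to `ε`): for a ladder whose rungs all have
conditional entropy at least `log k / k` (band floor `β⁻ ≥ 1`), a rung of conditional entropy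
`β log k / k` is new on all but a `(1 + β + ε) e^{-β}` fraction of the samples. -/
def CoverEnergyConjecture : Prop :=
  ∀ ε : ℝ, 0 < ε → ∃ k₀ : ℕ, ∀ k ≥ k₀, ∃ n₀ : ℕ, ∀ n ≥ n₀, ∀ L ≤ k,
    ∀ (y : Fin (L + 1) → Fin n → Bool) (l : Fin (L + 1)) (β : ℝ), l ≠ 0 → 1 ≤ β → β ≤ 5 →
      (∀ l' : Fin (L + 1), l' ≠ 0 →
        Real.log k / k ≤ condEnt ((List.ofFn y).take l'.val) (y l')) →
      condEnt ((List.ofFn y).take l.val) (y l) ≤ β * Real.log k / k →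
      (1 - (1 + β + ε) * Real.exp (-β)) * (n : ℝ) ^ k ≤
        ((univ : Finset (Fin k → Fin n)).filter fun I => IsNew y I l).card

end

end Summit.PneNP.PneNP.Cruxes.NoStableSection.SketchIdeator2

/-! ### Card C — hole-as-rung: the trajectory form (quantifier over trajectories INSIDE the count) -/

namespace Summit.PneNP.PneNP.Cruxes.NoStableSection.SketchIdeator2

open Finset Classical

/-- **Card C, transfer target `C⁺` (trajectory form of the crux).**  Same constants and splice as
the route decl `NoStableSection`, but the section `g` is replaced by an ARBITRARY trajectory
`x : Fin k → ℕ → (Fin n → Bool)` indexed by splice points, existentially quantified INSIDE the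
counted event: "on all but an `e^{-cn}` fraction of paths there is no ν-valid, ηn-stable trajectory
at all".  The g-free generalized-ladder first moment proves this; `NoStableSection` follows by
monotonicity (`trajectoryForm_imp`). -/
def TrajectoryForm : Prop :=
  ∃ k₀ : ℕ, ∀ k ≥ k₀, ∃ η : ℝ, 0 < η ∧ ∃ ν : ℝ, 0 < ν ∧ ∃ c : ℝ, 0 < c ∧ ∀ᶠ n : ℕ in Filter.atTop,
    ∀ m : ℕ, m = ⌊5 * 2 ^ k * Real.log k / k * n⌋₊ →
      ((Finset.univ.filter fun Ψ : Fin (k + 1) → Fin m → Fin k → Fin n × Bool =>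
        let P : Fin k → ℕ → Fin m → Fin k → Fin n × Bool :=
          fun r q a b => if (a : ℕ) * k + b < q then Ψ r.succ a b else Ψ r.castSucc a b
        ∃ x : Fin k → ℕ → (Fin n → Bool),
          (∀ r : Fin k, ∀ q ≤ m * k,
            ((Finset.univ.filter fun i : Fin m => ∀ j, x r q (P r q i j).1 ≠ (P r q i j).2).card : ℝ)
              ≤ ν * m) ∧
          (∀ r : Fin k, ∀ hr : r.val + 1 < k, x r (m * k) = x ⟨r.val + 1, hr⟩ 0) ∧
          ∀ r : Fin k, ∀ q < m * k, (hammingDist (x r q) (x r (q + 1)) : ℝ) ≤ η * n).card : ℝ)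
        ≤ Real.exp (-(c * n)) * Fintype.card (Fin (k + 1) → Fin m → Fin k → Fin n × Bool)

/-- **Card C, deterministic skeleton with the hole folded in** (compare `extraction`: the
probabilistic hypothesis `h_far` = `S_indep` is GONE; instead a rung is either a band rung or a
"timeout" rung taken exactly one window `W` after its predecessor with novelty still below `lo`).
Every valid stable trajectory therefore contains a generalized ladder, with no event excluded. -/
theorem extraction_total {V : Type*} (Hn : List V → V → ℝ) (x : ℕ → V) (T W L : ℕ)
    (lo hi δ : ℝ) (hLW : L * W ≤ T) (hW : 0 < W) (hδ : 0 ≤ δ) (hlo : 0 < lo) (hband : lo + δ ≤ hi)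
    (h_rep : ∀ (ts : List ℕ) (t : ℕ), t ∈ ts → Hn (ts.map x) (x t) = 0)
    (h_step : ∀ (ts : List ℕ) (t : ℕ), t < T →
      |Hn (ts.map x) (x (t + 1)) - Hn (ts.map x) (x t)| ≤ δ) :
    ∃ ts : ℕ → ℕ, ts 0 = 0 ∧
      (∀ l, l < L → ts l < ts (l + 1) ∧ ts (l + 1) ≤ ts l + W) ∧
      (∀ l, l < L →
        (lo ≤ Hn (((List.range (l + 1)).map ts).map x) (x (ts (l + 1))) ∧
          Hn (((List.range (l + 1)).map ts).map x) (x (ts (l + 1))) ≤ hi) ∨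
        (ts (l + 1) = ts l + W ∧
          Hn (((List.range (l + 1)).map ts).map x) (x (ts (l + 1))) < lo)) := by
  sorry

/-- **Card C, first lemma**: the trajectory form implies the crux as typed — instantiate the
trajectory with `x r q := g (P r q)` (the seam condition holds because `P r (m*k) = P (r+1) 0`
as functions) and use monotonicity of `Finset.card` under weakening of the filter predicate. -/
theorem trajectoryForm_imp :
    TrajectoryForm → Summit.PneNP.PneNP.Theses.OverlapGapAlgebra.NoStableSection := by
  rintro ⟨k₀, hk⟩
  refine ⟨k₀, fun k hkk => ?_⟩
  obtain ⟨η, hη, ν, hν, c, hc, hev⟩ := hk k hkk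
  refine ⟨η, hη, ν, hν, c, hc, ?_⟩
  filter_upwards [hev] with n hn
  intro m hm g
  refine le_trans ?_ (hn m hm)
  refine Nat.cast_le.2 (Finset.card_le_card fun Ψ hΨ => ?_)
  simp only [Finset.mem_filter, Finset.mem_univ, true_and] at hΨ ⊢
  obtain ⟨hval, hstab⟩ := hΨ
  refine ⟨fun r q => g (fun a b => if (a : ℕ) * k + b < q then Ψ r.succ a b else Ψ r.castSucc a b),
    hval, ?_, hstab⟩
  intro r hr
  -- seam: the instance at (r, m*k) and at (r+1, 0) is the same function
  refine congrArg g ?_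
  funext a b
  have hab : (a : ℕ) * k + b < m * k := by
    have ha : (a : ℕ) + 1 ≤ m := a.isLt
    have hb : (b : ℕ) < k := b.isLt
    calc (a : ℕ) * k + b < (a : ℕ) * k + k := by omega
      _ = ((a : ℕ) + 1) * k := by ring
      _ ≤ m * k := Nat.mul_le_mul_right k ha
  have h0 : ¬ ((a : ℕ) * k + b < 0) := Nat.not_lt_zero _
  have hidx : r.succ = Fin.castSucc ⟨r.val + 1, hr⟩ := Fin.ext (by simp)
  rw [if_pos hab, if_neg h0, hidx]

end Summit.PneNP.PneNP.Cruxes.NoStableSection.SketchIdeator2
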